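import Literature.NumberTheory.Rogawski1990.ArchOrbFamGUnfoldedModelIsolateFinset    -- ★ (M1) p851390 (this seat): `orbFamG_eq_unfoldedModel_pi_isolate_of_regG`; brings ★ (A5a), ★ (J-iso)^T, ★ (A4)
import Literature.NumberTheory.Rogawski1990.ArchOrbFamGExtMixedPartialModel         -- ★ (M3-a) (A-p12 (g28)): `contDiffOn_partialUnfoldedModel_pred`; brings ★ (J2-b) `continuous_readBlock`, ★ (A4′) `isOpen_setOf_inRegAt`, ★ `coe_archPiEquivCM_symm_apply`
import Literature.NumberTheory.Rogawski1990.ArchOrbFamGExtSmoothInRegG              -- ★ (A5) p851150 (F0P3b-p01 (g16)): the discharge kit (`exists_isHaarMeasure_eq_map_archPiEquivCM_symm_pi`, `chartHaarGLoc`, frames, Iwasawa constants)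
import HarnessLib

/-!
# (M3-b) THE PARTIAL UNFOLDED MODEL WITH A FINITE SET OF ISOLATED MATRIX SLOTS: the matrix of the assembled element, UNIFORM compact slot supports, the (M1) isolation
# identity read in MATRIX currency, and the discharged PACKAGE «PKG-T» for the `hCm` closer (Rogawski 1990 §4.9, §8.2–8.3; Folland 1995 §2.6; Borel–Jacquet 1979 §4.1)

Topic `NumberTheory/Rogawski1990`; namespaces `Literature.NumberTheory.Automorphic.UnitaryGroup` (§0–§1) and `Literature.NumberTheory.Rogawski1990` (§2–§3).  THEOREMS ONLY
(no `def`, no instance, no notation, no axiom, no named fact, no `sorry`).  Cell `pub/hodgecm-mathlib`, crux H413 (`stmt-HodgeConjecture-24833`), F0∕P3c line LH3 (closer stub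
`stub_N9`, DIRECT ROAD `F0_P3c_StubN9Direct`, LEAF v8), organ O-L1d′ «MIXED SCALAR CORNERS» (`stub_N9hcCentralMixedJetBounds`, `hCm`): leg **(M3-b)** «uniform block supports
+ discharge wiring» of F0P3a-p08 (g23)'s J2-MIXED spec (dealer LH3-plan (g4) 12:16:04Z), seat F0P3a-p05 (g21).  Count-neutral: nothing here closes an organ.

THE MATHEMATICS.  ★ (M1) `orbFamG_eq_unfoldedModel_pi_isolate_of_regG` writes the raw family `orbFamG ν′ a′ S′ c`, `c ∈ RegG S′`, as `(constants) · ∫_{Π_{p} U(α)_w} Θ_c((g_w γ_w(c)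
g_w⁻¹)_{p}) d(⊗_{p} ν′_w)` with `Θ_c` the partial unfolded model over the other places (split places unfolded to `K × N`, remaining compact places one flat quotient) read at the
GROUP family.  For the two-stage peeling of the `hCm` road the `p`-slots must be read as MATRICES `X_w ∈ M₃(ℂ)`:
* §0 **`coe_archPiEquivCM_symm_assemble_pred`** — the matrix of the element assembled by Mathlib `piEquivPiSubtypeProd … p` is the slot-wise INSERTION
  `(0, w ↦ [p w] ↑↑x_w ∣ ↑↑y_w)` (★ `coe_archPiEquivCM_symm_apply`; the predicate twin of ★ `coe_archPiEquivCM_symm_assemble`);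
* §1 **`exists_isCompact_pi_partialUnfoldedModel_integrand_eq_zero`** — UNIFORM COMPACT SLOT SUPPORT, MATRIX-SIDE: one compact `C ⊆ M₃(ℂ)` such that the recombined integrand
  `φ̃ (Matrix.of (a,b) ↦ (0, w ↦ [p w] (X_w)_{ab} ∣ [w ∈ S′] (T_w⁻¹ mu_w T_w)_{ab} ∣ (↑↑g_w)_{ab}))` (slot order of ★ (M3-a)) VANISHES as soon as ONE slot `X_w ∉ C` (whatever `mu`, `g`): `C` = the union over
  the (finitely many) `p`-places of the `w`-blocks of `tsupport φ̃` (★ `continuous_readBlock`; the finset twin of ★ (J2-b) `exists_isCompact_partialUnfoldedModel_integrand_eq_zero`,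
  kept matrix-side — the `hfC₂` shape of the MIXEDTOWER base family);
* §2 **`orbFamG_eq_matrixModel_pi_isolate_of_regG`** — ★ (M1) READ IN MATRIX CURRENCY: with the split frames read as fixed `T_j ∈ GL₃(ℂ)` (`hT`) and an ambient reading
  `a′ = φ̃ ∘ ↑↑` (`hφ̃f`, ★ `ArchSmooth.exists_contDiff`), the same identity with the integrand
  `g′ ↦ φ̃ (Matrix.of (a,b) ↦ (0, w ↦ [p w] (↑↑(g_w γ_w(c) g_w⁻¹))_{ab} ∣ [w ∈ S′] (T_w⁻¹ ↑↑(k_w τ(0,φ_w,θ_w) τ(x_w∕2,0,0) n_w τ(x_w∕2,0,0) k_w⁻¹) T_w)_{ab} ∣ (↑↑g′_w)_{ab}))`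
  (§0 + `hT` + `hφ̃f` under the two `∫` and `descConj_mk` — the bridge of ★ p851366's step (7), done once here for every finset of slots);
* §3 **`exists_partialUnfoldedModel_pi_isolate`** — THE DISCHARGED PACKAGE «PKG-T» (F0P3a-p08 (g23)'s binder text 2026-09-02T12:17:32Z): from the leaf's arbitrary Haar `ν′` on
  `G′_∞` and `a′ ∈ C_c^∞`, `∃ νl U u Θ C`: a right-invariant local Haar family `νl`, the open set `U = {in-regular at every remaining compact place} ∋ x`, a smooth unit `u` (here a
  constant: torus box masses × Iwasawa constants), the partial unfolded model `Θ` of ★ (M3-a) `contDiffOn_partialUnfoldedModel_pred` (A-p12 (g28)) at the discharged data — jointly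
  `C^∞` on `U ×ˢ univ` — ONE compact `C ⊆ M₃(ℂ)` with slot-wise vanishing (§1), and the identity `orbFamG ν′ a′ S′ c = (Π_{w∉S′} cpt_w(c)) · u c · ∫_{Π_{p} U(α)_w} Θ (c, (↑↑(g_w γ_w(c) g_w⁻¹))_w) d(⊗ νl)`
  on `U ∩ RegG S′` (§2 at the choices of ★ p851366's steps (0)–(5): product reading `exists_isHaarMeasure_eq_map_archPiEquivCM_symm_pi`, unimodularity, ★ `chartHaarGLoc`, ★
  `exists_haar_map_subgroupPiCoords_eq_pi`, ★ `exists_isCompact_subgroup_unitary_mul_borelU`, Haar on `K`∕`N`, ★ `exists_torusU_boostEig_family`, ★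
  `exists_continuousMulEquiv_archLocal_splitChart_torusU`, ★ `exists_map_cosetCongr_eq_smul_map_of_frame`, ★ `ArchSmooth.exists_contDiff`).
HONEST LABEL: HC_CM is proved only modulo the 7 printed citations (2 remaining: hLiu418 = `stmt-HodgeConjecture-24832`, h413 = `stmt-HodgeConjecture-24833`) until
rung 0 closes; this file moves no row of the books.

## References
* [Rogawski1990] J. D. Rogawski, *Automorphic Representations of Unitary Groups in Three Variables*, Ann. of Math. Stud. 123 (1990), §4.9 p. 55, §8.2 p. 122, §8.3 p. 124.
* [Folland1995] G. B. Folland, *A Course in Abstract Harmonic Analysis* (1995), §2.6 (2.52).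
* [BorelJacquet1979] A. Borel, H. Jacquet, *Automorphic forms and automorphic representations*, PSPM 33.1 (1979), §4.1.
* [DeitmarEchterhoff2014] A. Deitmar, S. Echterhoff, *Principles of Harmonic Analysis*, 2nd ed. (2014), Lemma 9.3.3.
-/

set_option autoImplicit false

noncomputable section

open MeasureTheory MeasureTheory.Measure Set NumberField NumberField.InfinitePlace NumberField.mixedEmbedding Complex Topology
open Literature.MeasureTheory.Group Literature.NumberTheory.Automorphic Literature.NumberTheory.Automorphic.UnitaryGroup Literature.NumberTheory.Automorphic.ArchCartan
open scoped ContDiff Classical ENNReal NNReal MatrixGroups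
open scoped Matrix.Norms.Operator

namespace Literature.NumberTheory.Automorphic.UnitaryGroup

/-! ## §0 The matrix of the element assembled by `piEquivPiSubtypeProd … p` -/

section Assemble

variable (L : Type) [Field L] [NumberField L] [IsCMField L] (N : ℕ) (α : Fin N → L)
  [∀ w : {w : InfinitePlace L // IsComplex w}, MeasurableSpace ↥(archLocal L N (Matrix.diagonal α) w)]

/-- **The matrix of the assembled element, predicate form**: for `x ∈ Π_{p} G_w` and `y ∈ Π_{¬p} G_w`, the matrix of `e⁻¹(x ∣ y)` (assembly through Mathlib
`piEquivPiSubtypeProd … p`) is the slot-wise insertion `(0, w ↦ [p w] ↑↑x_w ∣ ↑↑y_w)` into the complex coordinates (★ `coe_archPiEquivCM_symm_apply`; the one-slot case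
`p := (· = w₀)` is ★ `coe_archPiEquivCM_symm_assemble` up to `piUnique`). [cite: BorelJacquet1979, §4.1] -/
theorem coe_archPiEquivCM_symm_assemble_pred (p : {w : InfinitePlace L // IsComplex w} → Prop) [DecidablePred p]
    (x : ∀ w : {w : {w : InfinitePlace L // IsComplex w} // p w}, archLocal L N (Matrix.diagonal α) w.1)
    (y : ∀ w' : {w : {w : InfinitePlace L // IsComplex w} // ¬ p w}, archLocal L N (Matrix.diagonal α) w'.1) :
    ((((archPiEquivCM N L (Matrix.diagonal α)).symm
        ((MeasurableEquiv.piEquivPiSubtypeProd (fun w : {w : InfinitePlace L // IsComplex w} => ↥(archLocal L N (Matrix.diagonal α) w)) p).symm (x, y)) :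
        arch (↥(maximalRealSubfield L)) L (IsCMField.complexConj L) N (Matrix.diagonal α)) : GL (Fin N) (mixedSpace L)) : Matrix (Fin N) (Fin N) (mixedSpace L)) =
      Matrix.of fun i j => ((0 : {w : InfinitePlace L // IsReal w} → ℝ), fun w : {w : InfinitePlace L // IsComplex w} =>
        if h : p w then (((x ⟨w, h⟩ : archLocal L N (Matrix.diagonal α) w) : GL (Fin N) ℂ) : Matrix (Fin N) (Fin N) ℂ) i j
        else (((y ⟨w, h⟩ : archLocal L N (Matrix.diagonal α) w) : GL (Fin N) ℂ) : Matrix (Fin N) (Fin N) ℂ) i j) := by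
  rw [coe_archPiEquivCM_symm_apply]
  refine Matrix.ext fun i j => ?_
  simp only [Matrix.of_apply]
  refine Prod.ext rfl (funext fun w => ?_)
  dsimp only
  rw [piEquivPiSubtypeProd_symm_apply_dite]
  by_cases h : p w
  · rw [dif_pos h, dif_pos h]
  · rw [dif_neg h, dif_neg h]

end Assemble

/-! ## §1 Uniform compact slot supports, matrix-side -/

section Support

variable (L : Type) [Field L] [NumberField L] [IsCMField L] (α : Fin 3 → L) (S' : Finset {w : InfinitePlace L // IsComplex w})
  (p : {w : InfinitePlace L // IsComplex w} → Prop) [DecidablePred p] [Fintype {w : {w : InfinitePlace L // IsComplex w} // p w}]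

omit [NumberField L] [IsCMField L] in
/-- **UNIFORM COMPACT SLOT SUPPORT OF THE RECOMBINED INTEGRAND, MATRIX-SIDE** (the `hfC₂`-shape of the MIXEDTOWER base family): there is ONE
compact `C ⊆ M₃(ℂ)` — the union over the `p`-places `w` of the `w`-blocks of `tsupport φ̃` (★ `continuous_readBlock`) — such that the recombined integrand vanishes for EVERY
split datum `mu` and EVERY remaining-places family `g` as soon as ONE slot `X_w ∉ C`: that slot IS the `w`-block of the recombined matrix. (The one-slot, group-side case is ★
(J2-b) `exists_isCompact_partialUnfoldedModel_integrand_eq_zero`.) [cite: Rogawski1990, §8.2 p. 122] [cite: DeitmarEchterhoff2014, Lemma 9.3.3] -/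
theorem exists_isCompact_pi_partialUnfoldedModel_integrand_eq_zero
    (T : ↥S' → GL (Fin 3) ℂ) (φ : Matrix (Fin 3) (Fin 3) (mixedSpace L) → ℂ) (hφc : HasCompactSupport φ) :
    ∃ C : Set (Matrix (Fin 3) (Fin 3) ℂ), IsCompact C ∧
      ∀ (X : {w : {w : InfinitePlace L // IsComplex w} // p w} → Matrix (Fin 3) (Fin 3) ℂ), (∃ w, X w ∉ C) →
        ∀ (mu : ↥S' → Matrix (Fin 3) (Fin 3) ℂ) (g : ∀ i : {w : {w : InfinitePlace L // IsComplex w} // w ∉ S' ∧ ¬ p w}, ↥(archLocal L 3 (Matrix.diagonal α) i.1)),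
          φ (Matrix.of fun a b => ((0 : {w : InfinitePlace L // IsReal w} → ℝ),
            fun w : {w : InfinitePlace L // IsComplex w} =>
              if hw : p w then X ⟨w, hw⟩ a b
              else if h : w ∈ S' then ((((T ⟨w, h⟩)⁻¹ : GL (Fin 3) ℂ) : Matrix (Fin 3) (Fin 3) ℂ) * mu ⟨w, h⟩ * ((T ⟨w, h⟩ : GL (Fin 3) ℂ) : Matrix (Fin 3) (Fin 3) ℂ)) a b
              else ((((g ⟨w, ⟨h, hw⟩⟩ : ↥(archLocal L 3 (Matrix.diagonal α) w)) : GL (Fin 3) ℂ) : Matrix (Fin 3) (Fin 3) ℂ)) a b)) = 0 := by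
  refine ⟨⋃ w : {w : {w : InfinitePlace L // IsComplex w} // p w},
      (fun M : Matrix (Fin 3) (Fin 3) (mixedSpace L) => (Matrix.of fun a b => (M a b).2 w.1 : Matrix (Fin 3) (Fin 3) ℂ)) '' tsupport φ,
    isCompact_iUnion fun w => hφc.image (Literature.NumberTheory.Rogawski1990.continuous_readBlock L w.1), fun X hX mu g => ?_⟩
  obtain ⟨w, hw⟩ := hX
  refine image_eq_zero_of_notMem_tsupport fun hmem => hw (Set.mem_iUnion.2 ⟨w, _, hmem, ?_⟩)
  ext a b
  simp only [Matrix.of_apply, dif_pos w.2]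

end Support

end Literature.NumberTheory.Automorphic.UnitaryGroup

/-! ## §2 ★ (M1) read in MATRIX currency -/

namespace Literature.NumberTheory.Rogawski1990

section MatrixModel

variable (L : Type) [Field L] [NumberField L] [IsCMField L] (α : Fin 3 → L) (S' : Finset {w : InfinitePlace L // IsComplex w})
  [∀ w : {w : InfinitePlace L // IsComplex w}, MeasurableSpace ↥(archLocal L 3 (Matrix.diagonal α) w)]
  [∀ w : {w : InfinitePlace L // IsComplex w}, BorelSpace ↥(archLocal L 3 (Matrix.diagonal α) w)]
  [∀ w : {w : InfinitePlace L // IsComplex w}, LocallyCompactSpace ↥(archLocal L 3 (Matrix.diagonal α) w)]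
  [∀ w : {w : InfinitePlace L // IsComplex w}, SecondCountableTopology ↥(archLocal L 3 (Matrix.diagonal α) w)]
  [MeasurableSpace ↥(arch (↥(maximalRealSubfield L)) L (IsCMField.complexConj L) 3 (Matrix.diagonal α))]
  [BorelSpace ↥(arch (↥(maximalRealSubfield L)) L (IsCMField.complexConj L) 3 (Matrix.diagonal α))]
  [∀ w : {w : InfinitePlace L // IsComplex w}, MeasurableSpace (↥(archLocal L 3 (Matrix.diagonal α) w) ⧸ chartTorusGLoc L α w S')]
  [∀ w : {w : InfinitePlace L // IsComplex w}, BorelSpace (↥(archLocal L 3 (Matrix.diagonal α) w) ⧸ chartTorusGLoc L α w S')]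
  (ν'w : ∀ w : {w : InfinitePlace L // IsComplex w}, Measure ↥(archLocal L 3 (Matrix.diagonal α) w)) [∀ w, (ν'w w).IsHaarMeasure] [∀ w, (ν'w w).IsMulRightInvariant]
  (ν' : Measure ↥(arch (↥(maximalRealSubfield L)) L (IsCMField.complexConj L) 3 (Matrix.diagonal α))) [ν'.IsHaarMeasure] [ν'.IsMulRightInvariant]
  (hν : ν' = (Measure.pi ν'w).map (archPiEquivCM 3 L (Matrix.diagonal α)).symm)
  (t : ∀ w : {w : InfinitePlace L // IsComplex w}, Measure ↥(chartTorusGLoc L α w S')) [∀ w, (t w).IsHaarMeasure] [∀ w, (t w).IsInvInvariant]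
  -- the standard split group `U(J₃)(ℂ)` and the per-place transports (★ (A2)), VERBATIM ★ (A5a)
  {J : Matrix (Fin 3) (Fin 3) ℂ} (hJ : J = (StdForm.antidiagonal 3).over ℂ)
  [MeasurableSpace ↥(unitaryGroupOfForm (starRingEnd ℂ) J)] [BorelSpace ↥(unitaryGroupOfForm (starRingEnd ℂ) J)]
  [MeasurableSpace (↥(unitaryGroupOfForm (starRingEnd ℂ) J) ⧸ torusU (starRingEnd ℂ) J)] [BorelSpace (↥(unitaryGroupOfForm (starRingEnd ℂ) J) ⧸ torusU (starRingEnd ℂ) J)]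
  (φ : ∀ w : {w : {w : InfinitePlace L // IsComplex w} // w ∈ S'}, ↥(archLocal L 3 (Matrix.diagonal α) w.1) ≃ₜ* ↥(unitaryGroupOfForm (starRingEnd ℂ) J))
  (hφT : ∀ (w : {w : {w : InfinitePlace L // IsComplex w} // w ∈ S'}) (g : ↥(archLocal L 3 (Matrix.diagonal α) w.1)),
    (φ w).toMulEquiv g ∈ torusU (starRingEnd ℂ) J ↔ g ∈ chartTorusGLoc L α w.1 S')
  (hφd : ∀ (w : {w : {w : InfinitePlace L // IsComplex w} // w ∈ S'}) (cw : Fin 3 → ℝ),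
    glDiagonal 3 ℂ (fun i => Units.mk0 (boostEig cw i) (boostEig_ne_zero cw i)) = ((φ w (gprimeBlockAt L α w.1 S' cw) : ↥(unitaryGroupOfForm (starRingEnd ℂ) J)) : GL (Fin 3) ℂ))
  {K : Subgroup ↥(unitaryGroupOfForm (starRingEnd ℂ) J)} (κ : Measure ↥K) [SigmaFinite κ]
  (μN : Measure ↥(unipotentU (starRingEnd ℂ) J)) [IsHaarMeasure μN]
  {C : {w : {w : InfinitePlace L // IsComplex w} // w ∈ S'} → ℝ≥0}
  (hμC : ∀ w : {w : {w : InfinitePlace L // IsComplex w} // w ∈ S'},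
    (quotientMeasure (chartTorusGLoc L α w.1 S') (t w.1) (isClosed_chartTorusGLoc L α w.1 S') (ν'w w.1)).map
        (cosetCongr (φ w).toMulEquiv (chartTorusGLoc L α w.1 S') (torusU (starRingEnd ℂ) J) (hφT w)) =
      C w • Measure.map
        (fun p : ↥K × ↥(unipotentU (starRingEnd ℂ) J) =>
          (QuotientGroup.mk ((p.1 : ↥(unitaryGroupOfForm (starRingEnd ℂ) J)) * (p.2 : ↥(unitaryGroupOfForm (starRingEnd ℂ) J))) :
            ↥(unitaryGroupOfForm (starRingEnd ℂ) J) ⧸ torusU (starRingEnd ℂ) J))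
        (κ.prod μN))
  -- the boost torus family on `U(J₃)(ℂ)` (★ `exists_torusU_boostEig_family`), VERBATIM ★ (A5a)
  (τ : (Fin 3 → ℝ) → ↥(unitaryGroupOfForm (starRingEnd ℂ) J)) (hτT : ∀ c, τ c ∈ torusU (starRingEnd ℂ) J)
  (hτcoe : ∀ c, (((τ c : ↥(unitaryGroupOfForm (starRingEnd ℂ) J)) : GL (Fin 3) ℂ) : Matrix (Fin 3) (Fin 3) ℂ) = Matrix.diagonal (boostEig c))
  (hτmul : ∀ c c', τ (c + c') = τ c * τ c')
  (hτd : ∀ c, ∃ d : Fin 3 → ℂˣ, glDiagonal 3 ℂ d = ((τ c : ↥(unitaryGroupOfForm (starRingEnd ℂ) J)) : GL (Fin 3) ℂ) ∧ ∀ i, (d i : ℂ) = boostEig c i)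
  -- NEW: the isolated places — ANY decidable predicate on the complex places, `Fintype` instances of the two index subtypes as BINDERS (as ★ (J-iso)^T) — and the quotient of
  -- the REMAINING compact places, flat index `ι = {w ∕∕ w ∉ S′ ∧ ¬ p w}`
  (p : {w : InfinitePlace L // IsComplex w} → Prop) [DecidablePred p]
  [Fintype {w : {w : InfinitePlace L // IsComplex w} // p w}] [Fintype {w : {w : InfinitePlace L // IsComplex w} // ¬ p w}]
  [MeasurableSpace ((∀ i : {w : {w : InfinitePlace L // IsComplex w} // w ∉ S' ∧ ¬ p w}, ↥(archLocal L 3 (Matrix.diagonal α) i.1)) ⧸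
    Subgroup.pi Set.univ (fun i : {w : {w : InfinitePlace L // IsComplex w} // w ∉ S' ∧ ¬ p w} => chartTorusGLoc L α i.1 S'))]
  [BorelSpace ((∀ i : {w : {w : InfinitePlace L // IsComplex w} // w ∉ S' ∧ ¬ p w}, ↥(archLocal L 3 (Matrix.diagonal α) i.1)) ⧸
    Subgroup.pi Set.univ (fun i : {w : {w : InfinitePlace L // IsComplex w} // w ∉ S' ∧ ¬ p w} => chartTorusGLoc L α i.1 S'))]
  (ρι : Measure ↥(Subgroup.pi Set.univ (fun i : {w : {w : InfinitePlace L // IsComplex w} // w ∉ S' ∧ ¬ p w} => chartTorusGLoc L α i.1 S')))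
  [ρι.IsHaarMeasure] [ρι.IsInvInvariant]
  (hρι : Measure.map (subgroupPiCoords fun i : {w : {w : InfinitePlace L // IsComplex w} // w ∉ S' ∧ ¬ p w} => chartTorusGLoc L α i.1 S') ρι =
    Measure.pi fun i : {w : {w : InfinitePlace L // IsComplex w} // w ∉ S' ∧ ¬ p w} => t i.1)

include hν hJ hφT hφd hμC hτT hτcoe hτmul hτd hρι in
/-- **★ (M1) READ IN MATRIX CURRENCY.**  Binders = ★ (M1) `orbFamG_eq_unfoldedModel_pi_isolate_of_regG`'s VERBATIM, PLUS the split frames read as fixed matrices `T_j`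
(`hT : ↑((φ j)⁻¹ v) = T_j⁻¹ ↑v T_j`, ★ `exists_continuousMulEquiv_archLocal_splitChart_torusU`) and an ambient reading `a′ = φ̃ ∘ ↑↑` (`hφ̃f`, ★ `ArchSmooth.exists_contDiff`).  THEN
`orbFamG ν′ a′ S′ c = (Π_{w∉S′} cpt_w(c)) · (Π_{¬p} t_w(B′_w)) · (Π_{w∈S′} C_w) · ∫_{Π_{p} U(α)_w} ( ∫ descConj γ_ι(c) (Π_ι T′_w)
(g′ ↦ φ̃ (Matrix.of (a,b) ↦ (0, w ↦ [w ∈ S′] (T_w⁻¹ ↑↑(k_w τ τ n_w τ k_w⁻¹) T_w)_{ab} ∣ [p w] (↑↑(g_w γ_w(c) g_w⁻¹))_{ab} ∣ (↑↑g′_w)_{ab}))) d(((⊗_ι ν′_w)∕ρ_ι) ⊗ (⊗_{S′} κ⊗μ_N)) ) d(⊗_{p} ν′_w)(g)`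
— the `p`-slots as MATRICES `↑↑(g_w γ_w(c) g_w⁻¹)`, i.e. the integrand of (M3-a)'s partial unfolded model at the slot family (★ (M1) + §0 + `hT` + `hφ̃f` under the two integrals
and `descConj_mk`). [cite: Rogawski1990, §4.9 (4.9.1)–(4.9.2) p. 55; §8.2 p. 122; §8.3 p. 124] [cite: Folland1995, §2.6 (2.52)] [cite: BorelJacquet1979, §4.1] -/
theorem orbFamG_eq_matrixModel_pi_isolate_of_regG (hα : ∀ i, α i ≠ 0) (hS' : ∀ w, w ∈ S' → w ∈ splitChartPlaces L α) (hp : ∀ w, p w → w ∉ S')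
    {a' : ↥(arch (↥(maximalRealSubfield L)) L (IsCMField.complexConj L) 3 (Matrix.diagonal α)) → ℂ} (ha'c : Continuous a') (ha's : HasCompactSupport a')
    {c : {w : InfinitePlace L // IsComplex w} → Fin 3 → ℝ} (hc : c ∈ RegG S')
    (T : {w : {w : InfinitePlace L // IsComplex w} // w ∈ S'} → GL (Fin 3) ℂ)
    (hT : ∀ (j : {w : {w : InfinitePlace L // IsComplex w} // w ∈ S'}) (v : ↥(unitaryGroupOfForm (starRingEnd ℂ) J)),
      (((φ j).symm v : ↥(archLocal L 3 (Matrix.diagonal α) j.1)) : GL (Fin 3) ℂ) = (T j)⁻¹ * (v : GL (Fin 3) ℂ) * T j)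
    (φa : Matrix (Fin 3) (Fin 3) (mixedSpace L) → ℂ)
    (hφaf : ∀ k : ↥(arch (↥(maximalRealSubfield L)) L (IsCMField.complexConj L) 3 (Matrix.diagonal α)),
      a' k = φa (((k : ↥(arch (↥(maximalRealSubfield L)) L (IsCMField.complexConj L) 3 (Matrix.diagonal α))) : GL (Fin 3) (mixedSpace L)) : Matrix (Fin 3) (Fin 3) (mixedSpace L))) :
    orbFamG L α ν' a' S' c =
      (∏ w ∈ Finset.univ.filter (fun w => w ∉ S'),
          ((1 - (Circle.exp (c w 1 - c w 0) : ℂ)) * (1 - (Circle.exp (c w 2 - c w 0) : ℂ)) * (1 - (Circle.exp (c w 2 - c w 1) : ℂ)))) *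
        (∏ w' : {w : {w : InfinitePlace L // IsComplex w} // ¬ p w}, ((t w'.1 (chartBoxImgGLoc L α w'.1 S')).toReal : ℂ)) *
        ((∏ w : {w : {w : InfinitePlace L // IsComplex w} // w ∈ S'}, (C w : ℝ) : ℝ) : ℂ) *
        ∫ g : (∀ w : {w : {w : InfinitePlace L // IsComplex w} // p w}, ↥(archLocal L 3 (Matrix.diagonal α) w.1)),
          (∫ q : ((∀ i : {w : {w : InfinitePlace L // IsComplex w} // w ∉ S' ∧ ¬ p w}, ↥(archLocal L 3 (Matrix.diagonal α) i.1)) ⧸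
                Subgroup.pi Set.univ (fun i : {w : {w : InfinitePlace L // IsComplex w} // w ∉ S' ∧ ¬ p w} => chartTorusGLoc L α i.1 S')) ×
              ({w : {w : InfinitePlace L // IsComplex w} // w ∈ S'} → ↥K × ↥(unipotentU (starRingEnd ℂ) J)),
            descConj (fun i : {w : {w : InfinitePlace L // IsComplex w} // w ∉ S' ∧ ¬ p w} => gprimeBlock L α i.1 S' c)
              (Subgroup.pi Set.univ (fun i : {w : {w : InfinitePlace L // IsComplex w} // w ∉ S' ∧ ¬ p w} => chartTorusGLoc L α i.1 S'))
              (forall_mem_pi_chartTorusGLoc_comm L α S' (fun i : {w : {w : InfinitePlace L // IsComplex w} // w ∉ S' ∧ ¬ p w} => i.1) c)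
              (fun g' => φa (Matrix.of fun a b => ((0 : {w : InfinitePlace L // IsReal w} → ℝ),
                fun w : {w : InfinitePlace L // IsComplex w} =>
                  if hw : p w then
                    ((((g ⟨w, hw⟩ * gprimeBlockAt L α w S' (c w) * (g ⟨w, hw⟩)⁻¹ : ↥(archLocal L 3 (Matrix.diagonal α) w)) : GL (Fin 3) ℂ) : Matrix (Fin 3) (Fin 3) ℂ)) a b
                  else if h : w ∈ S' then
                    ((((T ⟨w, h⟩)⁻¹ : GL (Fin 3) ℂ) : Matrix (Fin 3) (Fin 3) ℂ) *
                      (((((q.2 ⟨w, h⟩).1 : ↥(unitaryGroupOfForm (starRingEnd ℂ) J)) *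
                          (τ ![0, c w 1, c w 2] * τ ![c w 0 / 2, 0, 0] * ((q.2 ⟨w, h⟩).2 : ↥(unitaryGroupOfForm (starRingEnd ℂ) J)) * τ ![c w 0 / 2, 0, 0]) *
                          ((q.2 ⟨w, h⟩).1 : ↥(unitaryGroupOfForm (starRingEnd ℂ) J))⁻¹ : ↥(unitaryGroupOfForm (starRingEnd ℂ) J)) : GL (Fin 3) ℂ) : Matrix (Fin 3) (Fin 3) ℂ) *
                      ((T ⟨w, h⟩ : GL (Fin 3) ℂ) : Matrix (Fin 3) (Fin 3) ℂ)) a b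
                  else ((((g' ⟨w, ⟨h, hw⟩⟩ : ↥(archLocal L 3 (Matrix.diagonal α) w)) : GL (Fin 3) ℂ) : Matrix (Fin 3) (Fin 3) ℂ)) a b)))
              q.1
            ∂((quotientMeasure (Subgroup.pi Set.univ (fun i : {w : {w : InfinitePlace L // IsComplex w} // w ∉ S' ∧ ¬ p w} => chartTorusGLoc L α i.1 S')) ρι
                  (isClosed_coe_pi _ fun i => isClosed_chartTorusGLoc L α i.1 S')
                  (Measure.pi fun i : {w : {w : InfinitePlace L // IsComplex w} // w ∉ S' ∧ ¬ p w} => ν'w i.1)).prod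
              (Measure.pi fun _ : {w : {w : InfinitePlace L // IsComplex w} // w ∈ S'} => κ.prod μN)))
          ∂(Measure.pi fun w : {w : {w : InfinitePlace L // IsComplex w} // p w} => ν'w w.1) := by
  rw [orbFamG_eq_unfoldedModel_pi_isolate_of_regG L α S' ν'w ν' hν t hJ φ hφT hφd κ μN hμC τ hτT hτcoe hτmul hτd p ρι hρι hα hS' hp ha'c ha's hc]
  congr 1
  refine integral_congr_ae (Filter.Eventually.of_forall fun g => ?_)
  dsimp only
  refine integral_congr_ae (Filter.Eventually.of_forall fun q => ?_)
  obtain ⟨y, η⟩ := q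
  induction y using QuotientGroup.induction_on with
  | H g₁ =>
    dsimp only
    rw [descConj_mk, descConj_mk, hφaf, coe_archPiEquivCM_symm_assemble_pred]
    congr 1
    refine Matrix.ext fun a b => Prod.ext rfl (funext fun w₁ => ?_)
    simp only [Matrix.of_apply]
    by_cases hw₁ : p w₁
    · rw [dif_pos hw₁, dif_pos hw₁]
    · by_cases h : w₁ ∈ S'
      · rw [dif_neg hw₁, dif_pos h, dif_neg hw₁, dif_pos h, hT, Units.val_mul, Units.val_mul]
      · rw [dif_neg hw₁, dif_neg h, dif_neg hw₁, dif_neg h]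

end MatrixModel

/-! ## §3 THE PACKAGE «PKG-T» for the `hCm` closer: the discharged partial unfolded model with a finite set of isolated matrix slots -/

section Package

variable (L : Type) [Field L] [NumberField L] [IsCMField L] (α : Fin 3 → L)
  [MeasurableSpace ↥(arch (↥(maximalRealSubfield L)) L (IsCMField.complexConj L) 3 (Matrix.diagonal α))]
  [BorelSpace ↥(arch (↥(maximalRealSubfield L)) L (IsCMField.complexConj L) 3 (Matrix.diagonal α))]
  (ν' : Measure ↥(arch (↥(maximalRealSubfield L)) L (IsCMField.complexConj L) 3 (Matrix.diagonal α))) [ν'.IsHaarMeasure] [ν'.IsMulRightInvariant]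

/-- **PKG-T — THE DISCHARGED PARTIAL UNFOLDED MODEL WITH A FINITE SET OF ISOLATED MATRIX SLOTS** (F0P3a-p08 (g23)'s binder text, 2026-09-02T12:17:32Z; the (M1)+(M3) input
of the `hCm` model).  For the diagonal house frame (`hα hreal`), an admissible chart `S′`, `a′ ∈ C_c^∞(G′_∞)`, ANY Haar `ν′` on `G′_∞`, a decidable predicate `p` of compact
places (`hp`) and a base point `x` in-regular at every remaining compact place (`hxin`): THERE ARE a right-invariant local Haar family `νl` (the product reading of `ν′`, ★
`exists_isHaarMeasure_eq_map_archPiEquivCM_symm_pi` + unimodularity), the open set `U = {c ∣ in-regular at every w ∉ S′, ¬ p w} ∋ x` (★ `isOpen_setOf_inRegAt`), a smooth unit `u`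
(here the CONSTANT «torus box masses × Iwasawa constants» of ★ (M1)), the partial unfolded model `Θ` of ★ (M3-a) `contDiffOn_partialUnfoldedModel_pred` (A-p12 (g28)) at the
discharged data (★ p851366 steps (0)–(5): `chartHaarGLoc`, `ρ_ι`, `U(J₃)(ℂ)` with `K, κ, μ_N, τ`, frames `φ_j` read as `T_j`, Iwasawa constants `C_j`, ambient lift `φ̃` of `a′`) — jointly
`C^∞` on `U ×ˢ univ` — and ONE compact `C ⊆ M₃(ℂ)` with slot-wise vanishing (§1), such that on `U ∩ RegG S′`
`orbFamG ν′ a′ S′ c = (Π_{w∉S′} (1−e^{i(c₁−c₀)})(1−e^{i(c₂−c₀)})(1−e^{i(c₂−c₁)})) · u c · ∫_{Π_{p} U(α)_w} Θ (c, (↑↑(g_w γ_w(c) g_w⁻¹))_w) d(⊗_{p} νl_w)(g)` (§2) — the Weyl trigonometric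
product kept as a SEPARATE factor. [cite: Rogawski1990, §4.9 (4.9.1)–(4.9.2) p. 55; §8.2 p. 122; §8.3 p. 124] [cite: Varadarajan1977, I §1.12] [cite: Folland1995, §2.6 (2.52)]
[cite: Shelstad1979, §4 pp. 22–24] [cite: BorelJacquet1979, §4.1] -/
theorem exists_partialUnfoldedModel_pi_isolate (hα : ∀ i, α i ≠ 0)
    (hreal : ∀ (w : {w : InfinitePlace L // IsComplex w}) (i : Fin 3), (w.1.embedding (α i)).im = 0)
    {S' : Finset {w : InfinitePlace L // IsComplex w}} (hS' : ∀ w, w ∈ S' → w ∈ splitChartPlaces L α)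
    {a' : ↥(arch (↥(maximalRealSubfield L)) L (IsCMField.complexConj L) 3 (Matrix.diagonal α)) → ℂ} (ha' : ArchSmooth L 3 (Matrix.diagonal α) a')
    (p : {w : InfinitePlace L // IsComplex w} → Prop) [DecidablePred p] (hp : ∀ w, p w → w ∉ S')
    {x : {w : InfinitePlace L // IsComplex w} → Fin 3 → ℝ}
    (hxin : ∀ w : {w : InfinitePlace L // IsComplex w}, w ∉ S' → ¬ p w → ∀ i j : Fin 3, i ≠ j → slotSign L α w i ≠ slotSign L α w j →
      Circle.exp (x w i) ≠ Circle.exp (x w j))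
    [∀ w : {w : InfinitePlace L // IsComplex w}, MeasurableSpace ↥(archLocal L 3 (Matrix.diagonal α) w)]
    [∀ w : {w : InfinitePlace L // IsComplex w}, BorelSpace ↥(archLocal L 3 (Matrix.diagonal α) w)] :
    ∃ (νl : ∀ w : {w : InfinitePlace L // IsComplex w}, Measure ↥(archLocal L 3 (Matrix.diagonal α) w))
      (_ : ∀ w, (νl w).IsHaarMeasure) (_ : ∀ w, (νl w).IsMulRightInvariant)
      (U : Set ({w : InfinitePlace L // IsComplex w} → Fin 3 → ℝ)) (u : ({w : InfinitePlace L // IsComplex w} → Fin 3 → ℝ) → ℂ)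
      (Θ : ({w : InfinitePlace L // IsComplex w} → Fin 3 → ℝ) × ({w : {w : InfinitePlace L // IsComplex w} // p w} → Matrix (Fin 3) (Fin 3) ℂ) → ℂ)
      (C : Set (Matrix (Fin 3) (Fin 3) ℂ)),
      IsOpen U ∧ x ∈ U ∧ ContDiffOn ℝ ∞ u U ∧ ContDiffOn ℝ ∞ Θ (U ×ˢ univ) ∧ IsCompact C ∧
      (∀ (c : {w : InfinitePlace L // IsComplex w} → Fin 3 → ℝ) (Y : {w : {w : InfinitePlace L // IsComplex w} // p w} → Matrix (Fin 3) (Fin 3) ℂ),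
        (∃ w, Y w ∉ C) → Θ (c, Y) = 0) ∧
      ∀ c ∈ U ∩ RegG S', orbFamG L α ν' a' S' c =
        (∏ w ∈ Finset.univ.filter (fun w => w ∉ S'),
            ((1 - (Circle.exp (c w 1 - c w 0) : ℂ)) * (1 - (Circle.exp (c w 2 - c w 0) : ℂ)) * (1 - (Circle.exp (c w 2 - c w 1) : ℂ)))) * u c *
          ∫ g : (∀ w : {w : {w : InfinitePlace L // IsComplex w} // p w}, ↥(archLocal L 3 (Matrix.diagonal α) w.1)),
            Θ (c, fun w => (((g w * gprimeBlockAt L α w.1 S' (c w.1) * (g w)⁻¹ : ↥(archLocal L 3 (Matrix.diagonal α) w.1)) : GL (Fin 3) ℂ) : Matrix (Fin 3) (Fin 3) ℂ))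
            ∂(Measure.pi fun w : {w : {w : InfinitePlace L // IsComplex w} // p w} => νl w.1) := by
  /- (0) topological facts on the local groups; Borel structures on the chart quotients and on the quotient of the remaining compact places (★ p851366 step (0)) -/
  haveI : ∀ v : {w : InfinitePlace L // IsComplex w}, LocallyCompactSpace ↥(archLocal L 3 (Matrix.diagonal α) v) := fun v => locallyCompactSpace_archLocal_three L α v
  haveI : ∀ v : {w : InfinitePlace L // IsComplex w}, SecondCountableTopology ↥(archLocal L 3 (Matrix.diagonal α) v) := fun v => secondCountableTopology_archLocal_three L α v
  letI : ∀ v : {w : InfinitePlace L // IsComplex w}, MeasurableSpace (↥(archLocal L 3 (Matrix.diagonal α) v) ⧸ chartTorusGLoc L α v S') := fun v => borel _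
  haveI : ∀ v : {w : InfinitePlace L // IsComplex w}, BorelSpace (↥(archLocal L 3 (Matrix.diagonal α) v) ⧸ chartTorusGLoc L α v S') := fun v => ⟨rfl⟩
  letI : MeasurableSpace ((∀ i : {w : {w : InfinitePlace L // IsComplex w} // w ∉ S' ∧ ¬ p w}, ↥(archLocal L 3 (Matrix.diagonal α) i.1)) ⧸
      Subgroup.pi Set.univ (fun i : {w : {w : InfinitePlace L // IsComplex w} // w ∉ S' ∧ ¬ p w} => chartTorusGLoc L α i.1 S')) := borel _
  haveI : BorelSpace ((∀ i : {w : {w : InfinitePlace L // IsComplex w} // w ∉ S' ∧ ¬ p w}, ↥(archLocal L 3 (Matrix.diagonal α) i.1)) ⧸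
      Subgroup.pi Set.univ (fun i : {w : {w : InfinitePlace L // IsComplex w} // w ∉ S' ∧ ¬ p w} => chartTorusGLoc L α i.1 S')) := ⟨rfl⟩
  /- (1) the product reading of `ν′`; every local factor is right invariant (unimodularity) -/
  obtain ⟨ν'w, hν'w, hν⟩ := exists_isHaarMeasure_eq_map_archPiEquivCM_symm_pi L 3 α ν'
  haveI : ∀ v, (ν'w v).IsHaarMeasure := hν'w
  haveI : ∀ v, (ν'w v).IsMulRightInvariant := fun v => isMulRightInvariant_of_isHaarMeasure_archLocal_diagonal_of_im_eq_zero L α hα v (hreal v) (ν'w v)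
  /- (2) torus Haar measures: the local `chartHaarGLoc`, and `ρ_ι` on the product of the chart tori at the remaining compact places -/
  haveI : ∀ v : {w : InfinitePlace L // IsComplex w}, (chartHaarGLoc L α v S').IsHaarMeasure := fun v => isHaarMeasure_chartHaarGLoc L α v S'
  haveI : ∀ v : {w : InfinitePlace L // IsComplex w}, (chartHaarGLoc L α v S').IsInvInvariant := fun v => isInvInvariant_chartHaarGLoc L α v S'
  haveI : ∀ v : {w : InfinitePlace L // IsComplex w}, SigmaFinite (chartHaarGLoc L α v S') := fun v => sigmaFinite_chartHaarGLoc L α v S'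
  obtain ⟨ρι, hρι1, hρι2, hρι⟩ := exists_haar_map_subgroupPiCoords_eq_pi
    (fun i : {w : {w : InfinitePlace L // IsComplex w} // w ∉ S' ∧ ¬ p w} => chartTorusGLoc L α i.1 S') (fun i => isClosed_chartTorusGLoc L α i.1 S')
    (fun i : {w : {w : InfinitePlace L // IsComplex w} // w ∉ S' ∧ ¬ p w} => chartHaarGLoc L α i.1 S')
  haveI := hρι1
  haveI := hρι2
  /- (3) the standard split group `U(J₃)(ℂ)`: `K`, `κ`, `μ_N`, the boost torus family `τ` -/
  obtain ⟨J, hJ⟩ : ∃ J : Matrix (Fin 3) (Fin 3) ℂ, J = (StdForm.antidiagonal 3).over ℂ := ⟨_, rfl⟩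
  letI : MeasurableSpace ↥(unitaryGroupOfForm (starRingEnd ℂ) J) := borel _
  haveI : BorelSpace ↥(unitaryGroupOfForm (starRingEnd ℂ) J) := ⟨rfl⟩
  letI : MeasurableSpace (↥(unitaryGroupOfForm (starRingEnd ℂ) J) ⧸ torusU (starRingEnd ℂ) J) := borel _
  haveI : BorelSpace (↥(unitaryGroupOfForm (starRingEnd ℂ) J) ⧸ torusU (starRingEnd ℂ) J) := ⟨rfl⟩
  haveI : LocallyCompactSpace ↥(unitaryGroupOfForm (starRingEnd ℂ) J) := locallyCompactSpace_unitaryGroupOfForm_complex J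
  haveI : SecondCountableTopology ↥(unitaryGroupOfForm (starRingEnd ℂ) J) := secondCountableTopology_unitaryGroupOfForm_complex J
  obtain ⟨K, hK, -, hKB⟩ := exists_isCompact_subgroup_unitary_mul_borelU hJ
  haveI : CompactSpace ↥K := isCompact_iff_compactSpace.mp hK
  haveI : LocallyCompactSpace ↥K := hK.isClosed.isClosedEmbedding_subtypeVal.locallyCompactSpace
  obtain ⟨κ, hκ⟩ : ∃ κ : Measure ↥K, κ.IsHaarMeasure := ⟨Measure.haar, inferInstance⟩
  haveI := hκ
  have hN : IsClosed (unipotentU (starRingEnd ℂ) J : Set ↥(unitaryGroupOfForm (starRingEnd ℂ) J)) := LineRing.isClosed_unipotentU _ _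
  haveI : LocallyCompactSpace ↥(unipotentU (starRingEnd ℂ) J) := hN.isClosedEmbedding_subtypeVal.locallyCompactSpace
  obtain ⟨μN, hμN⟩ : ∃ μN : Measure ↥(unipotentU (starRingEnd ℂ) J), μN.IsHaarMeasure := ⟨Measure.haar, inferInstance⟩
  haveI := hμN
  obtain ⟨τ, hτT, hτcoe, hτmul, hτd⟩ := exists_torusU_boostEig_family hJ
  /- (4) the split frames `φ_v`, their matrices `T_v`, the Iwasawa constants `C_v` -/
  choose φ hφ hT hφT using fun v : ↥S' => exists_continuousMulEquiv_archLocal_splitChart_torusU L α v.1 hα (hS' _ v.2) hJ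
  choose T hT using hT
  have hφT' : ∀ (v : ↥S') (g : ↥(archLocal L 3 (Matrix.diagonal α) v.1)), (φ v).toMulEquiv g ∈ torusU (starRingEnd ℂ) J ↔ g ∈ chartTorusGLoc L α v.1 S' :=
    fun v g => hφT v S' hS' v.2 g
  have hφd : ∀ (v : ↥S') (cw : Fin 3 → ℝ), glDiagonal 3 ℂ (fun i => Units.mk0 (boostEig cw i) (boostEig_ne_zero cw i)) =
      ((φ v (gprimeBlockAt L α v.1 S' cw) : ↥(unitaryGroupOfForm (starRingEnd ℂ) J)) : GL (Fin 3) ℂ) := fun v cw => (hφ v S' (fun _ => cw) v.2).2.1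
  have hC : ∀ v : ↥S', ∃ C : NNReal, 0 < C ∧
      (quotientMeasure (chartTorusGLoc L α v.1 S') (chartHaarGLoc L α v.1 S') (isClosed_chartTorusGLoc L α v.1 S') (ν'w v.1)).map
          (cosetCongr (φ v).toMulEquiv (chartTorusGLoc L α v.1 S') (torusU (starRingEnd ℂ) J) (hφT' v)) = C • Measure.map
        (fun q : ↥K × ↥(unipotentU (starRingEnd ℂ) J) =>
          (QuotientGroup.mk ((q.1 : ↥(unitaryGroupOfForm (starRingEnd ℂ) J)) * (q.2 : ↥(unitaryGroupOfForm (starRingEnd ℂ) J))) :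
            ↥(unitaryGroupOfForm (starRingEnd ℂ) J) ⧸ torusU (starRingEnd ℂ) J))
        (κ.prod μN) := fun v => by
    haveI := smulInvariantMeasure_quotientMeasure (chartTorusGLoc L α v.1 S') (chartHaarGLoc L α v.1 S') (isClosed_chartTorusGLoc L α v.1 S') (ν'w v.1)
    exact exists_map_cosetCongr_eq_smul_map_of_frame hJ (chartTorusGLoc L α v.1 S') (φ v) (hφT' v) hK hKB κ μN _
      (quotientMeasure_ne_zero (chartTorusGLoc L α v.1 S') (chartHaarGLoc L α v.1 S') (isClosed_chartTorusGLoc L α v.1 S') (ν'w v.1))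
  choose C _ hμC using hC
  have hsymm : ∀ (v : ↥S') (w : ↥(unitaryGroupOfForm (starRingEnd ℂ) J)),
      (((φ v).symm w : ↥(archLocal L 3 (Matrix.diagonal α) v.1)) : GL (Fin 3) ℂ) = (T v)⁻¹ * (w : GL (Fin 3) ℂ) * T v := fun v w => by
    have h := hT v ((φ v).symm w)
    rw [ContinuousMulEquiv.apply_symm_apply] at h
    rw [h]
    group
  /- (5) the ambient lift of `a′` -/
  obtain ⟨φa, hφa, hφac, -, hφaf⟩ := ha'.exists_contDiff
  /- (6) the model: joint smoothness (★ (M3-a), A-p12 (g28)), uniform slot support (§1) -/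
  haveI : IsFiniteMeasureOnCompacts (Measure.pi fun _ : ↥S' => κ.prod μN) := inferInstance
  have hΘ := contDiffOn_partialUnfoldedModel_pred L α S' p hα hreal hS' hp
    (quotientMeasure (Subgroup.pi Set.univ (fun i : {w : {w : InfinitePlace L // IsComplex w} // w ∉ S' ∧ ¬ p w} => chartTorusGLoc L α i.1 S')) ρι
      (isClosed_coe_pi _ fun i => isClosed_chartTorusGLoc L α i.1 S')
      (Measure.pi fun i : {w : {w : InfinitePlace L // IsComplex w} // w ∉ S' ∧ ¬ p w} => ν'w i.1))
    hJ K hK (Measure.pi fun _ : ↥S' => κ.prod μN) τ hτcoe T φa hφa hφac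
  obtain ⟨Cm, hCm, hzero⟩ := exists_isCompact_pi_partialUnfoldedModel_integrand_eq_zero L α S' p T φa hφac
  /- (7) the package -/
  refine ⟨ν'w, inferInstance, inferInstance, _, fun _ =>
      (∏ w' : {w : {w : InfinitePlace L // IsComplex w} // ¬ p w}, ((chartHaarGLoc L α w'.1 S' (chartBoxImgGLoc L α w'.1 S')).toReal : ℂ)) *
        ((∏ v : ↥S', (C v : ℝ) : ℝ) : ℂ), _, Cm,
    isOpen_setOf_inRegAt L α (fun i : {w : {w : InfinitePlace L // IsComplex w} // w ∉ S' ∧ ¬ p w} => i.1),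
    fun i a b hab hs => hxin i.1 i.2.1 i.2.2 a b hab hs, contDiffOn_const, hΘ, hCm, fun c Y hY => ?_, fun c hc => ?_⟩
  · -- slot-wise vanishing: the integrand vanishes identically once one slot is off `Cm`
    refine integral_eq_zero_of_ae (Filter.Eventually.of_forall fun r => ?_)
    obtain ⟨y, η⟩ := r
    induction y using QuotientGroup.induction_on with
    | H g₁ =>
      dsimp only
      rw [descConj_mk]
      exact hzero Y hY (fun j : ↥S' => (((((η j).1 : ↥(unitaryGroupOfForm (starRingEnd ℂ) J)) *
          (τ ![0, c j.1 1, c j.1 2] * τ ![c j.1 0 / 2, 0, 0] * ((η j).2 : ↥(unitaryGroupOfForm (starRingEnd ℂ) J)) * τ ![c j.1 0 / 2, 0, 0]) *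
          ((η j).1 : ↥(unitaryGroupOfForm (starRingEnd ℂ) J))⁻¹ : ↥(unitaryGroupOfForm (starRingEnd ℂ) J)) : GL (Fin 3) ℂ) : Matrix (Fin 3) (Fin 3) ℂ))
        (g₁ * (fun i : {w : {w : InfinitePlace L // IsComplex w} // w ∉ S' ∧ ¬ p w} => gprimeBlock L α i.1 S' c) * g₁⁻¹)
  · -- the isolation identity ★ (M1) in matrix currency (§2), constants folded into the unit
    rw [orbFamG_eq_matrixModel_pi_isolate_of_regG L α S' ν'w ν' hν (fun v => chartHaarGLoc L α v S') hJ φ hφT' hφd κ μN hμC τ hτT hτcoe hτmul hτd p ρι hρι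
      hα hS' hp ha'.continuous ha'.hasCompactSupport hc.2 T hsymm φa hφaf]
    simp only [mul_assoc]

end Package

end Literature.NumberTheory.Rogawski1990

end
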